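import Literature.Analysis.FluidPDE.ElgindiKMomentEnergy
import Mathlib.Analysis.SpecialFunctions.ImproperIntegrals
import HarnessLib

/-!
# A uniform bound for `L₁₂(h)` by the weighted radial energy of its `K`-moment
([Elgindi2021] §7.5: the corrector `G⋆ = −(4α)⁻¹L₁₂(F)`)

Topic `Literature/Analysis/FluidPDE`. Proof file (everything proved, no definitions, no named
facts) on the proof path of the named fact
`Literature.Analysis.FluidPDE.Elgindi.ElgindiGhoulMasmoudi2021_stabilityCore`
(`ElgindiStabilityDecomposition.lean`). T. M. Elgindi, Ann. of Math. 194 (2021) =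
arXiv:1904.04795, §7.5 (p. 24).

`sup_R |L₁₂(h)(R)| ≤ √2·(radialEnergy 0 (kMoment h))^{1/2}` for smooth `h` compactly supported
inside the open strip (`abs_L12_le`): Cauchy–Schwarz on `∫ |m(r)|/r = ∫ (|m|w)·(1/(rw))` with
`∫₀^∞ dr/(r²w²) = ∫₀^∞ r²/(1+r)⁴dr ≤ 2`. This is the uniform (support-independent) control of the
non-square-integrable part `G⋆ ⊗ sin 2θ` of the Theorem 2 solution, used to pass to limits in the
data locally in `L¹`.
-/

noncomputable section

open MeasureTheory Set Function Real Filter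
open _root_.Topology
open scoped ENNReal

namespace Literature.Analysis.FluidPDE

namespace Elgindi

/-- `∫₀^∞ r²/(1+r)⁴ dr ≤ 2` (in `ℝ≥0∞`). [folklore] -/
theorem lintegral_inv_sq_radialWeight_le :
    ∫⁻ r in Ioi (0:ℝ), ENNReal.ofReal (1 / (r ^ 2 * radialWeight r ^ 2)) ≤ 2 := by
  have hsplit : Ioi (0:ℝ) = Ioc 0 1 ∪ Ioi 1 := (Ioc_union_Ioi_eq_Ioi zero_le_one).symm
  rw [hsplit, lintegral_union measurableSet_Ioi (Ioc_disjoint_Ioi le_rfl)]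
  have h1 : ∫⁻ r in Ioc (0:ℝ) 1, ENNReal.ofReal (1 / (r ^ 2 * radialWeight r ^ 2)) ≤ 1 := by
    calc ∫⁻ r in Ioc (0:ℝ) 1, ENNReal.ofReal (1 / (r ^ 2 * radialWeight r ^ 2)) ≤ ∫⁻ _ in Ioc (0:ℝ) 1, 1 := by
          refine setLIntegral_mono' measurableSet_Ioc fun r hr => ?_
          rw [← ENNReal.ofReal_one]
          refine ENNReal.ofReal_le_ofReal ?_
          have hr0 : 0 < r := hr.1
          unfold radialWeight
          rw [div_le_one (by positivity)]
          have : r ^ 2 * ((1 + r) ^ 2 / r ^ 2) ^ 2 = (1 + r) ^ 4 / r ^ 2 := by field_simp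
          rw [this, le_div_iff₀ (by positivity)]
          nlinarith [hr.1, hr.2, pow_pos hr0 2, pow_pos hr0 3]
      _ = 1 := by rw [setLIntegral_const, Real.volume_Ioc]; norm_num
  have h2 : ∫⁻ r in Ioi (1:ℝ), ENNReal.ofReal (1 / (r ^ 2 * radialWeight r ^ 2)) ≤ 1 := by
    have hi : IntegrableOn (fun r : ℝ => r ^ (-2:ℝ)) (Ioi 1) := integrableOn_Ioi_rpow_of_lt (by norm_num) one_pos
    have hv : ∫ r in Ioi (1:ℝ), r ^ (-2:ℝ) = 1 := by
      rw [integral_Ioi_rpow_of_lt (by norm_num) one_pos]; norm_num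
    calc ∫⁻ r in Ioi (1:ℝ), ENNReal.ofReal (1 / (r ^ 2 * radialWeight r ^ 2)) ≤ ∫⁻ r in Ioi (1:ℝ), ENNReal.ofReal (r ^ (-2:ℝ)) := by
          refine setLIntegral_mono' measurableSet_Ioi fun r hr => ENNReal.ofReal_le_ofReal ?_
          have hr0 : 0 < r := zero_lt_one.trans hr
          unfold radialWeight
          rw [Real.rpow_neg hr0.le, Real.rpow_two]
          rw [show r ^ 2 * ((1 + r) ^ 2 / r ^ 2) ^ 2 = (1 + r) ^ 4 / r ^ 2 by field_simp, one_div_div,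
            div_le_iff₀ (by positivity), ← div_eq_inv_mul, le_div_iff₀ (by positivity)]
          nlinarith [pow_pos hr0 2, pow_pos hr0 3, pow_pos hr0 4, hr]
      _ = ENNReal.ofReal (∫ r in Ioi (1:ℝ), r ^ (-2:ℝ)) := by
          rw [ofReal_integral_eq_lintegral_ofReal hi ((ae_restrict_iff' measurableSet_Ioi).2 (ae_of_all _ fun r hr =>
            Real.rpow_nonneg (zero_lt_one.trans hr).le _))]
      _ = 1 := by rw [hv, ENNReal.ofReal_one]
  calc _ ≤ (1:ℝ≥0∞) + 1 := add_le_add h1 h2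
    _ = 2 := by norm_num

/-- **`|L₁₂(h)(R)| ≤ √2·(radialEnergy 0 (kMoment h))^{1/2}`** for smooth `h` compactly supported
inside the open strip. [cite: Elgindi2021, §7.5 (p. 24 of arXiv:1904.04795)] -/
theorem abs_L12_le {h : ℝ → ℝ → ℝ} (hh : ContDiff ℝ 0 (uncurry h)) (hs : HasCompactSupport (uncurry h))
    (hsub : tsupport (uncurry h) ⊆ strip) (R : ℝ) :
    ENNReal.ofReal |L12 h R| ≤ ENNReal.ofReal (Real.sqrt 2) * (radialEnergy 0 (kMoment h)) ^ (1 / 2 : ℝ) := by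
  have hc : Continuous (uncurry h) := hh.continuous
  obtain ⟨a, b, ha, hab, hrad⟩ := exists_radial_bounds' hs hsub
  have hkc : Continuous fun r => kMoment h r / r := continuous_kMoment_div hc ha hrad
  -- `|L₁₂ h R| ≤ ∫_{r>0} |kMoment h r|/r`
  have hm0 : ∀ r, r ∉ Icc a b → kMoment h r = 0 := fun r hr => by
    have h' : r < a ∨ b < r := by
      by_contra h''; simp only [not_or, not_lt] at h''; exact hr ⟨h''.1, h''.2⟩
    exact kMoment_eq_zero_of_not_mem hrad h'
  have hks : HasCompactSupport fun r => kMoment h r / r :=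
    HasCompactSupport.of_support_subset_isCompact (isCompact_Icc (a := a) (b := b)) fun r hr => by
      by_contra h'; exact hr (by show kMoment h r / r = 0; rw [hm0 r h', zero_div])
  have hi : Integrable fun r => kMoment h r / r := hkc.integrable_of_hasCompactSupport hks
  have step1 : |L12 h R| ≤ ∫ r in Ioi (0:ℝ), |kMoment h r / r| := by
    rw [L12_eq_integral_kMoment_div]
    calc |∫ r in Ioi R, kMoment h r / r| ≤ ∫ r in Ioi R, |kMoment h r / r| := abs_integral_le_integral_abs
      _ ≤ ∫ r in Ioi (0:ℝ), |kMoment h r / r| := by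
          by_cases hR : 0 ≤ R
          · exact setIntegral_mono_set hi.abs.integrableOn (ae_of_all _ fun r => abs_nonneg _) (ae_of_all _ (Ioi_subset_Ioi hR))
          · -- for `R < 0` the integrand vanishes on `(R, 0]`
            rw [not_le] at hR
            have e : ∫ r in Ioi R, |kMoment h r / r| = ∫ r in Ioi (0:ℝ), |kMoment h r / r| := by
              rw [← integral_indicator measurableSet_Ioi, ← integral_indicator measurableSet_Ioi]
              refine integral_congr_ae (ae_of_all _ fun r => ?_)
              by_cases hr : r ∈ Ioi (0:ℝ)
              · rw [indicator_of_mem hr, indicator_of_mem (show r ∈ Ioi R from hR.trans hr)]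
              · rw [indicator_of_notMem hr]
                by_cases hr' : r ∈ Ioi R
                · rw [indicator_of_mem hr', hm0 r fun h' => hr (ha.trans_le h'.1), zero_div, abs_zero]
                · rw [indicator_of_notMem hr']
            rw [e]
  -- Cauchy–Schwarz in `ℝ≥0∞`
  set F : ℝ → ℝ≥0∞ := fun r => ENNReal.ofReal (|kMoment h r| * radialWeight r) with hF
  set G : ℝ → ℝ≥0∞ := fun r => ENNReal.ofReal (1 / (r * radialWeight r)) with hG
  have mw : Measurable radialWeight := by unfold radialWeight; fun_prop
  have mk : Measurable fun r => |kMoment h r| := continuous_abs.measurable.comp (continuous_kMoment hc).measurable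
  have mF : AEMeasurable F (volume.restrict (Ioi 0)) := ((mk.mul mw).ennreal_ofReal).aemeasurable
  have mG : AEMeasurable G (volume.restrict (Ioi 0)) := by
    have : Measurable fun r : ℝ => 1 / (r * radialWeight r) := by unfold radialWeight; fun_prop
    exact this.ennreal_ofReal.aemeasurable
  have hH := ENNReal.lintegral_mul_le_Lp_mul_Lq (volume.restrict (Ioi (0:ℝ))) Real.HolderConjugate.two_two mF mG
  -- identify the three integrals
  have eFG : ∀ r ∈ Ioi (0:ℝ), (F * G) r = ENNReal.ofReal |kMoment h r / r| := by
    intro r hr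
    have hw : 0 < radialWeight r := radialWeight_pos hr
    have hr0 : (0:ℝ) < r := hr
    simp only [Pi.mul_apply, hF, hG]
    rw [← ENNReal.ofReal_mul (by positivity)]
    congr 1
    rw [abs_div, abs_of_pos hr0]
    field_simp
  have eF2 : ∀ r ∈ Ioi (0:ℝ), F r ^ (2:ℝ) = ENNReal.ofReal (radialWeight r ^ 2 * (Dz₁^[0] (kMoment h)) r ^ 2) := by
    intro r hr
    have hw : 0 < radialWeight r := radialWeight_pos hr
    simp only [hF, Function.iterate_zero, id_eq]
    rw [show (2:ℝ) = ((2:ℕ) : ℝ) by norm_num, ENNReal.rpow_natCast, ← ENNReal.ofReal_pow (mul_nonneg (abs_nonneg _) hw.le)]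
    congr 1; rw [mul_pow, sq_abs]; ring
  have eG2 : ∀ r ∈ Ioi (0:ℝ), G r ^ (2:ℝ) = ENNReal.ofReal (1 / (r ^ 2 * radialWeight r ^ 2)) := by
    intro r hr
    have hw : 0 < radialWeight r := radialWeight_pos hr
    have hr0 : (0:ℝ) < r := hr
    simp only [hG]
    rw [show (2:ℝ) = ((2:ℕ) : ℝ) by norm_num, ENNReal.rpow_natCast, ← ENNReal.ofReal_pow (by positivity)]
    congr 1; field_simp
  rw [setLIntegral_congr_fun measurableSet_Ioi eFG, setLIntegral_congr_fun measurableSet_Ioi eF2, setLIntegral_congr_fun measurableSet_Ioi eG2] at hH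
  -- the real integral as a lintegral
  have step2 : ENNReal.ofReal (∫ r in Ioi (0:ℝ), |kMoment h r / r|) = ∫⁻ r in Ioi (0:ℝ), ENNReal.ofReal |kMoment h r / r| :=
    ofReal_integral_eq_lintegral_ofReal hi.abs.integrableOn (ae_of_all _ fun r => abs_nonneg _)
  calc ENNReal.ofReal |L12 h R| ≤ ENNReal.ofReal (∫ r in Ioi (0:ℝ), |kMoment h r / r|) := ENNReal.ofReal_le_ofReal step1
    _ = ∫⁻ r in Ioi (0:ℝ), ENNReal.ofReal |kMoment h r / r| := step2
    _ ≤ (∫⁻ r in Ioi (0:ℝ), ENNReal.ofReal (radialWeight r ^ 2 * (Dz₁^[0] (kMoment h)) r ^ 2)) ^ (1 / (2:ℝ)) *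
          (∫⁻ r in Ioi (0:ℝ), ENNReal.ofReal (1 / (r ^ 2 * radialWeight r ^ 2))) ^ (1 / (2:ℝ)) := hH
    _ ≤ (radialEnergy 0 (kMoment h)) ^ (1 / 2 : ℝ) * (2:ℝ≥0∞) ^ (1 / (2:ℝ)) := by
        refine mul_le_mul' (le_of_eq rfl) (ENNReal.rpow_le_rpow lintegral_inv_sq_radialWeight_le (by norm_num))
    _ = ENNReal.ofReal (Real.sqrt 2) * (radialEnergy 0 (kMoment h)) ^ (1 / 2 : ℝ) := by
        rw [mul_comm]
        congr 1
        rw [Real.sqrt_eq_rpow, ← ENNReal.ofReal_ofNat 2, ← ENNReal.ofReal_rpow_of_pos (by norm_num : (0:ℝ) < 2)]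

end Elgindi

end Literature.Analysis.FluidPDE
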